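import Mathlib
import Literature.MathematicalPhysics.QuantumFieldTheory.Balaban1983to89.B14RelBoundary
import Literature.MathematicalPhysics.QuantumFieldTheory.Balaban1983to89.B12TreeDecay

/-!
# `Balaban1983to89.B14.RelAnimal` — the RELATIVE anchored tree-graph bound behind [Balaban1988Convergent] p. 262
ll. 6–15 / [Balaban1989LargeFieldII] (1.67), (1.99) (= [Dimock2013BalabanII] App. E, Lemma E.3), KERNEL-CHECKED from
the connected-lattice-animal count modulo ONE quoted geometric leaf, and the ring anchors of `B14.RelBoundary` as
THEOREMS over a concrete cube carrier

CITATION HEADER (lean-in-tree rule 2026-08-18).  Sources: T. Bałaban, *Convergent renormalization expansions for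
lattice gauge theories*, Commun. Math. Phys. **119**, 243–285 (1988) [Balaban1988Convergent] (cell paper B14 = [III];
held `paper:balaban1988-cmp119-convergent-renormalization`, journal page = PDF page + 242); T. Bałaban, *Large field
renormalization. II. Localization, exponentiation, and bounds for the 𝐑 operation*, Commun. Math. Phys. **122**,
355–392 (1989) [Balaban1989LargeFieldII] (cell paper B16; held `paper:balaban1989-cmp122-large-field-ii`, journal page =
PDF page + 354); T. Bałaban, *Renormalization group approach to lattice gauge field theories. I*, Commun. Math. Phys.
**109**, 249–301 (1987) [Balaban1987RG1] (= [I], cell paper B12); J. Dimock, *The renormalization group according to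
Balaban. II. Large fields*, J. Math. Phys. **54**, 092301 (2013) = arXiv:1212.5562v2 [Dimock2013BalabanII] (held
`paper:arxiv-1212.5562`; TeX source read in the cell folder `inputs/files/dimock/src/1212.5562/1212.5562.tex`, line
numbers "L…" below refer to it; numbering: `\newtheorem{lem}{Lemma}[section]`, appendices A–F, App. E =
`\section{disconnected polymer sums}` L6776).  Quotations of [III]/B16 were read on the page renders (cell folder
`b2b-balaban-ref1/pages/…`) and are the ones verified verbatim for `B14.RelBoundary` (cell GAPS C-pv17-12).  The
Bałaban papers are manuscripts UNDER ADJUDICATION by the audit cell `pub-balaban`: nothing printed in them is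
asserted here.  Every `theorem` below is finite combinatorics or real arithmetic, proved without `sorry` and without
new axioms; the ONE geometric input (the relative Steiner-animal bound, `RelAnimalLeaf`) is an explicit named
hypothesis, never asserted, with its published proof cited.  NEW sibling module of unit `b2b-balaban-b01` (gen 3);
it imports and does not modify `…B14RelBoundary` (same unit, gen 2: `RingAnchor`, `RelAnchoredBound`,
`scaleBound_of_relDecay`) and `…B12TreeDecay` (unit pv03: the cube carrier `CubeSystem`, the constants `a₀`,
`smallness_a₀`), and through them unit b02's `B16.RelDomainSys` and the tree's
`Probability.LatticeModels.PolymerGasGeometric` (`sum_pow_card_le_of_connected`, `rcomponent`).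

WHAT IS PRINTED.  [III] p. 254 [12] (2.1) *"Ω_1 ⊃ Λ_1 ⊃ Ω_2 ⊃ Λ_2 ⊃ … ⊃ Ω_k ⊃ Λ_k"*, p. 255 [13] (2.3) *"Z_j = Λ_j^c"*;
p. 259 [17] *"Λ_j^0 the set which is obtained by removing one layer of the MR_j-cubes from Λ_j^{(j)}"*; p. 261 [19]
(2.41) *"where the sum is over domains X ∈ 𝐃_j such, that X∩Ω_j ≠ ∅, and X∩Z_j^~ ≠ ∅"* with [I] p. 257 [9] *"For a
cube □ ∈ π_j and n = 1, 2, … we define □̃ⁿ as a cube of the size (1+2n)M and with a center at the center of □ … The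
meaning of the symbol X̃ⁿ should be obvious"*; p. 262 [20], second paragraph *"we may resum all the terms with
localization domains intersecting a given component of the large field region. This gives sum (2.41), with the
summation over domains X ∈ 𝐃_j such that X either contains a component of the large field region Z_j, or is disjoint
with it. Resumming we lose a part of the exponential factor in (2.42), connected with the region Z_j; hence for the new
terms we obtain the bound (2.42) with d_j(X) replaced by d_j(X∖Z_j). All constructions and proofs of the procedure can
be carried on with these inductive assumptions. We have chosen the ones above, because they agree with the assumptions
for 𝐄-terms and 𝐑-terms"* (closing sentence: the alternative is printed AND DECLINED by [III] — cell GAPS G-ref1-9);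
B16 p. 376 [22] (1.67) *"d_{k,Z}(Y) [is] M^{−1}(the length of a shortest tree graph contained in Y and intersecting all
M-cubes of the components of Y∖Z)"*.  THE SAME CLASS AND SIZE IN [Dimock2013BalabanII] §3.1.2
(L1676–1705), verbatim: *"A variation is a polymer with holes. Given a final small field region Ω_k (not necessarily
connected) on the same torus, suppose the large field region Ω_k^c has connected components Ω^c_{k,α} … We define a
subset of 𝒟_k by 𝒟_k(mod Ω^c_k) = {X ⊂ 𝒟_k : for all α either Ω^c_{k,α} ⊂ X or Ω^c_{k,α}, X are disjoint} … M
d_M(X, mod Ω^c_k) = inf_{τ on X} ℓ(τ) where the infimum is over all continuuum tree graphs τ contained in X and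
intersecting every M-cube in X ∩ Ω_k, and ℓ(τ) is the length of τ … For any M-cube □ ∈ Ω_k we have for a universal
constants κ₀, K₀:  Σ_{X ∈ 𝒟_k(mod Ω^c_k), X ⊃ □} e^{−κ₀ d_M(X mod Ω^c_k)} ≤ K₀  [display (snow)]. See appendix E for the
proof."*, and App. E Lemma E.3 (L6914–6920), verbatim: *"Let Ω be a union of M-cubes. For □ ⊂ Ω and constants κ₀, K₀ =
𝒪(1):  Σ_{X ∈ 𝒟_k(mod Ω^c), X ⊃ □} exp(−κ₀ d_M(X, mod Ω^c)) ≤ K₀  [display (sumsum)]"* — PROVED there (L6923–6966: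
classify X by Y = X ∩ Ω; *"Since X is connected each non-empty X ∩ Ω^c_α must have a block sharing a face with a
block in Y. Thus the number of non-empty X ∩ Ω^c_α is at most 2^d|Y|_M … Thus there are less than 2^{2^d|Y|_M} such
X"*; then Lemma E.1 (L6790–6798) *"1. ℓ_M(Y) ≤ 2ℓ̃_M(Y)  2. ℓ′_M(Y) ≤ ℓ_M(Y) + |Y|_M  3. |Y|_M ≤ 4(2^d+1)(ℓ_M(Y)+1)"*
and Lemma E.2 (L6833–6845, tree-length decay of disconnected sums, via Cayley's formula)).  Dictionary: Dimock's `Ω` ↦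
[III]'s `Λ_j` (cumulative small-field region, GAPS G-b01-J2 (2)), `Ω^c` with its components ↦ `Z_j = Λ_j^c`,
`𝒟_k(mod Ω^c)` ↦ the resummed class of p. 262, `d_M(X, mod Ω^c)` ↦ `d_{j,Z_j}(X)` of (1.67) (unit b02's abstract
`RelDomainSys.dRel`), `□ ⊂ Ω` ↦ a cube of the small-field part `S(X) = X∖Z_j`.

WHAT THIS FILE TYPES AND PROVES (cell GAPS.md C-b01-J4; discharges the located hypotheses H2 and H4 of C-b01-J1).
* §1 `exists_exit` — the first-exit step along a chain (pure logic).
* §2 the carrier `RelCubeSystem S` = pv03's `B12TreeDecay.CubeSystem` (cubes, a symmetric adjacency `Adj` with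
  neighbour lists, the cubes of each domain, injective, each domain `Adj`-connected) over b02's `B16.RelDomainSys`,
  EXTENDED by the sets of one scale — `Omega` (Ω_j), `Lam` (Λ_j), `Lam0` (Λ_j^0), `Z` (Z_j) — with the located facts as
  fields: (2.1) `Lam ⊆ Omega`; p. 259 `Lam0 ⊆ Lam` and `layer` (a neighbour of a cube of Λ_j^0 lies in Λ_j: one layer of
  MR_j-cubes, R_j ≥ 1, was removed); (2.3) `mem_Z_iff` (Z_j = Λ_j^c); the index set `adm` of the resummed (2.41) with
  p. 262's *"either contains a component … or is disjoint with it"* as the closure field `glued` (a Z_j-neighbour of a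
  Z_j-cube of X is a cube of X; ⇔ every `Adj`-component of Z_j meeting X lies in X, `rcomponent_subset_cubes`) and
  (2.41)'s `X∩Ω_j ≠ ∅` (`meets_omega`), `X∩Z_j^~ ≠ ∅` (`meets_Ztilde`: a cube of X in Z_j or adjacent to one).
  `Adj` is abstract; its INTENDED instantiation is corner adjacency of M-cubes (*-adjacency, `Δ = 3^d − 1` neighbours),
  for which (i) domains are connected, (ii) the components of the closed set Z_j are the `Adj`-components, (iii) the
  M-cubes met by a continuum tree form an `Adj`-connected family, (iv) X̃ = X plus its `Adj`-neighbours ([I] p. 257).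
* §3 `RelAnimalLeaf c₀` — THE QUOTED LEAF (a `def … : Prop`, never asserted): every domain with `S(X) ≠ ∅` contains an
  `Adj`-connected family `A` of cubes with `S(X) ⊆ A ⊆ X` and `#A ≤ c₀(1 + d_{j,Z_j}(X))`.  In the intended model take
  `A` = the M-cubes of X met by an optimal tree τ of (1.67) (length `M·D`): τ ⊂ X meets every cube of S(X), the met
  cubes are *-connected, and choosing one point of τ per met cube gives `ℓ̃_M(A) ≤ D`, whence Lemma E.1 (1),(3):
  `#A ≤ 4(2^d+1)(2D+1) ≤ 8(2^d+1)(1+D)` — `c₀ = 8(2^d+1)` (= 136 for d = 4), the constant of pv03's `VolumeLeaf`; the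
  absolute analogue is kernel-proved in unit pv22's `TreeLength` (`card_le_steinerLen`).
* §4 the count: `comps X` (components of Z_j inside X), `adjComps A` (components of Z_j adjacent to A, `#adjComps A ≤
  Δ·#A`), `comps_subset_adjComps` (Dimock's *"must have a block sharing a face with a block in Y"*, here with Y ↦ the
  animal A ⊇ S(X)), `code_injOn` (X is determined by `(S(X), comps X)`), `card_fibre_le` (at most `2^{#A}·2^{Δ#A}`
  admissible X have small part inside a given animal A — Dimock's `2^{2^d|Y|_M}` with the animal in place of Y).
* §5 the constants `arel Δ = a₀(Δ) + (Δ+1)log 2`, `kapparel c₀ Δ = c₀·arel Δ`, `Krel c₀ Δ = e^{kapparel}(Δ+1)^{−2}` and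
  `relTreeBound` = LEMMA E.3 / (snow) / H4 KERNEL-CHECKED modulo the leaf: for `Adj`-degree ≤ Δ, `RelAnimalLeaf c₀` and
  every `κ ≥ kapparel c₀ Δ`, for every cube □: `Σ_{X ∈ adm, □ ∈ S(X)} exp(−κ·d_{j,Z_j}(X)) ≤ Krel c₀ Δ` (`sumsum`: the
  same with `X ⊃ □`, `□ ⊄ Z_j`).  PROOF ROUTE (NOT Dimock's): termwise `exp(−κ d) ≤ e^{kapparel}·e^{−arel·#A(X)}` by the
  leaf; regroup over the animals `A ∋ □` (fibres ≤ `(2^{Δ+1})^{#A}`), so the sum is `≤ e^{kapparel} Σ_{A∋□, connected}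
  (2^{Δ+1}e^{−arel})^{#A} = e^{kapparel} Σ_A e^{−a₀#A} ≤ e^{kapparel}·2e^{−a₀}` by the tree's animal count
  `sum_pow_card_le_of_connected` ((Δ+1)²e^{−a₀} = ½) — Dimock instead keeps the decay in the tree length ℓ_M(Y) of the
  possibly disconnected Y = X∩Ω and sums with Lemma E.2 (Cayley's formula); the animal route needs only Lemma E.1.
* §6 the anchors (H2 of C-b01-J1 as theorems): a PURE admissible domain (`S(X) = ∅`) is ONE component of Z_j
  (`cubes_eq_rcomponent_of_pure`), two pure admissible domains sharing a cube coincide (`eq_of_pure_of_mem`), and it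
  owns a cube of `Ω_j∖Λ_j ⊆ ring := Ω_j∖Λ_j^0`; a NON-PURE admissible domain owns a small cube adjacent to Z_j
  (`exists_small_firstLayer`: walk inside the connected X from its cube in Z_j^~ to S(X); first exit), which lies in
  `Λ_j∖Λ_j^0 ⊆ ring` (`mem_ring_of_firstLayer`, by `layer`).  Hence `ringAnchor : B14.RelBoundary.RingAnchor S` (fibres =
  the level sets of the anchor map) and `relAnchoredBound`: `RelAnchoredBound S ringAnchor κ (Krel c₀ Δ + 1)` for
  `κ ≥ kapparel c₀ Δ`, `c₀ ≥ 0` (pure fibre ≤ 1 term ≤ 1; non-pure fibre ≤ `relTreeBound`).  H1 (`ring ⊆ Γ_j`) is the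
  inclusion `ring_subset_Gamma` under `Ω_{j+1} ⊆ Λ_j^0` (kernel-located by unit pv02 gen 2, `B14DomainGeom.
  omega35_subset_lambda0`, [III] p. 265 (3.5) + (2.9); GAPS C-B14s-05).
* §7 `scaleBound` — gen 2's `scaleBound_of_relDecay` with H2/H4 DISCHARGED: termwise relative decay `‖B X‖ ≤
  B₀exp(−κ d_{j,Z_j}(X))` on `adm` ⇒ `‖Σ_{X∈adm} B X‖ ≤ B₀(Krel c₀ Δ + 1)·#ring ≤ B₀(Krel+1)·#(Ω_j∖Ω_{j+1})`
  (`scaleBound_Gamma`), i.e. the per-scale input of (2.48) with `B₁ = B₀(Krel+1)M^{−d}`, modulo the leaf and the degree.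

NOT TYPED HERE: the leaf itself (continuum trees; its absolute form is pv22's `TreeLength`), the bounds (2.42)/(1.99),
the 𝐓-step.  The constants are not optimised (`kapparel(136, 80) ≈ 8.9·10³`; print: "κ sufficiently large").
Value = kernel discharge of located hypotheses + located published source, NOT summit progress.
-/

open Finset

namespace Literature.MathematicalPhysics.QuantumFieldTheory.Balaban1983to89.B14.RelAnimal

open Literature.Probability.LatticeModels
open B12TreeDecay (a₀ a₀_nonneg exp_neg_a₀ smallness_a₀)

/-! ## 1. First exit along a chain -/

/-- FIRST EXIT: if a chain of `R`-steps leads from a point where `P` holds to a point where it fails, some step of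
the chain leaves `P` (pure logic; the step behind Dimock's *"must have a block sharing a face with a block in Y"*,
L6940–6941, and behind [III]'s anchors). [folklore] -/
theorem exists_exit {V : Type*} {R : V → V → Prop} (P : V → Prop) {a b : V}
    (h : Relation.ReflTransGen R a b) (ha : P a) (hb : ¬ P b) : ∃ x y, R x y ∧ P x ∧ ¬ P y := by
  induction h with
  | refl => exact absurd ha hb
  | @tail b' c' _ hbc ih =>
    by_cases hPb : P b'
    · exact ⟨b', c', hbc, hPb, hb⟩
    · exact ih hPb

/-! ## 2. The carrier: cubes, the sets of one scale, the resummed admissible class -/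

/-- The cube geometry of ONE scale `j` of [III] §2 over unit b02's `B16.RelDomainSys` (domains `X ∈ 𝐃_j` with the full
size `d_j` and the relative size `dRel = d_{j,Z_j}` of (1.67)): pv03's `CubeSystem` (the cubes `□ ∈ π_j`, a symmetric
adjacency with neighbour lists, the cubes of each domain — injective, `Adj`-connected) EXTENDED by `Omega` = the
M-cubes of Ω_j, `Lam` = of Λ_j, `Lam0` = of Λ_j^0, `Z` = of Z_j, and the index set `adm` of the resummed (2.41), with
the LOCATED FACTS as fields: (2.1) p. 254 `Ω_j ⊃ Λ_j`; p. 259 *"Λ_j^0 the set which is obtained by removing one layer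
of the MR_j-cubes from Λ_j^{(j)}"* (`lam0_subset_lam`, `layer`); (2.3) *"Z_j = Λ_j^c"* (`mem_Z_iff`); p. 262 *"X either
contains a component of the large field region Z_j, or is disjoint with it"* (`glued`, closure form); (2.41) *"X∩Ω_j ≠
∅, and X∩Z_j^~ ≠ ∅"* (`meets_omega`, `meets_Ztilde`, X̃ of [I] p. 257 = X with one layer of neighbouring cubes).
Intended `Adj` = corner adjacency of M-cubes (module docstring (i)–(iv)). [cite: Balaban1988Convergent, (2.41) p.261, p.262 ll.6-15] -/
structure RelCubeSystem (S : B16.RelDomainSys) extends B12TreeDecay.CubeSystem S.toLocDomainSys where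
  /-- the M-cubes of `Ω_j` -/
  Omega : Finset Cube
  /-- the M-cubes of `Λ_j` -/
  Lam : Finset Cube
  /-- the M-cubes of `Λ_j^0` -/
  Lam0 : Finset Cube
  /-- the M-cubes of the large-field region `Z_j` -/
  Z : Finset Cube
  /-- (2.1): `Λ_j ⊂ Ω_j` -/
  lam_subset_omega : Lam ⊆ Omega
  /-- p. 259: `Λ_j^0 ⊂ Λ_j` -/
  lam0_subset_lam : Lam0 ⊆ Lam
  /-- p. 259: one layer was removed — every neighbour of a cube of `Λ_j^0` is a cube of `Λ_j` -/
  layer : ∀ a ∈ Lam0, ∀ b, Adj a b → b ∈ Lam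
  /-- (2.3): `Z_j = Λ_j^c` -/
  mem_Z_iff : ∀ a, a ∈ Z ↔ a ∉ Lam
  /-- the index set of the resummed (2.41) (p. 262) -/
  adm : Finset S.Dom
  /-- p. 262: an admissible domain containing a cube of `Z_j` contains its whole component (closure form) -/
  glued : ∀ X ∈ adm, ∀ a ∈ cubes X, a ∈ Z → ∀ b ∈ Z, Adj a b → b ∈ cubes X
  /-- (2.41): `X ∩ Ω_j ≠ ∅` -/
  meets_omega : ∀ X ∈ adm, ∃ a ∈ cubes X, a ∈ Omega
  /-- (2.41): `X ∩ Z_j^~ ≠ ∅` -/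
  meets_Ztilde : ∀ X ∈ adm, ∃ a ∈ cubes X, a ∈ Z ∨ ∃ b ∈ Z, Adj a b

namespace RelCubeSystem

variable {S : B16.RelDomainSys} (G : RelCubeSystem S)

/-- `S(X) := X∖Z_j`, the small-field part of a domain, as a family of cubes (p. 262 "d_j(X∖Z_j)"; GAPS C-b01-J1).
[cite: Balaban1988Convergent, p.262 ll.6-15] -/
def small (X : S.Dom) : Finset G.Cube := G.cubes X \ G.Z

/-- The RING `Ω_j∖Λ_j^0` of gen 2's anchoring (GAPS C-b01-J1 (H1)), as a family of cubes. [cite: Balaban1988Convergent, (2.48) p.264] -/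
def ring : Finset G.Cube := G.Omega \ G.Lam0

/-- Membership in `S(X)`. [folklore] -/
theorem mem_small {X : S.Dom} {a : G.Cube} : a ∈ G.small X ↔ a ∈ G.cubes X ∧ a ∉ G.Z := Finset.mem_sdiff

/-- `S(X) ⊂ X`. [folklore] -/
theorem small_subset_cubes (X : S.Dom) : G.small X ⊆ G.cubes X := Finset.sdiff_subset

/-- (2.3): `S(X) = X∖Z_j ⊂ Λ_j`. [cite: Balaban1988Convergent, (2.3) p.255] -/
theorem small_subset_lam (X : S.Dom) : G.small X ⊆ G.Lam := by
  intro a ha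
  by_contra h
  exact (G.mem_small.1 ha).2 ((G.mem_Z_iff a).2 h)

/-- A domain with `S(X) = ∅` ("pure") consists of cubes of `Z_j`. [folklore] -/
theorem cubes_subset_Z_of_small_eq_empty {X : S.Dom} (h : G.small X = ∅) : G.cubes X ⊆ G.Z := by
  intro a ha
  by_contra haZ
  have hmem : a ∈ G.small X := G.mem_small.2 ⟨ha, haZ⟩
  rw [h] at hmem
  exact Finset.notMem_empty a hmem

/-- p. 262 in component form: the `Adj`-component of `Z_j` through a `Z_j`-cube of an admissible domain lies in the
domain (induction along the chain, field `glued`). [cite: Balaban1988Convergent, p.262 ll.6-15] -/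
theorem rcomponent_subset_cubes {X : S.Dom} (hX : X ∈ G.adm) {a : G.Cube} (ha : a ∈ G.cubes X) :
    rcomponent G.Adj G.Z a ⊆ G.cubes X := by
  intro q hq
  obtain ⟨-, hchain⟩ := mem_rcomponent.1 hq
  clear hq
  induction hchain with
  | refl => exact ha
  | @tail b c _ hbc ih => exact G.glued X hX b ih hbc.2.1 c hbc.2.2 hbc.1

/-! ## 3. The quoted geometric leaf -/

/-- **THE QUOTED LEAF** (never asserted): every domain with nonempty small-field part contains an `Adj`-connected
family of cubes `A` with `S(X) ⊆ A ⊆ X` and `#A ≤ c₀(1 + d_{j,Z_j}(X))`.  In the intended model `A` = the M-cubes of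
X met by an optimal tree of (1.67) (*"contained in Y and intersecting all M-cubes of the components of Y∖Z"*, length
`M·D`): choosing one point of the tree per met cube, [Dimock2013BalabanII] App. E, L6788 *"But we do have ℓ̃_M(Y) ≤
d_M(Y)"* (here `ℓ̃_M(A) ≤ D`) and Lemma E.1 (L6790–6798), verbatim *"1. ℓ_M(Y) ≤ 2ℓ̃_M(Y) … 3. |Y|_M ≤
4(2^d+1)(ℓ_M(Y)+1)"*, give `#A ≤ 8(2^d+1)(1 + D)`: `c₀ = 8(2^d+1)` (136 for d = 4), as in pv03's `VolumeLeaf`; absolute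
analogue kernel-proved in pv22's `TreeLength.card_le_steinerLen`. [cite: Dimock2013BalabanII, App. E Lemma E.1 (arXiv:1212.5562v2 TeX L6776-6798)] -/
def RelAnimalLeaf (c₀ : ℝ) : Prop :=
  ∀ X : S.Dom, (G.small X).Nonempty →
    ∃ A : Finset G.Cube, G.small X ⊆ A ∧ A ⊆ G.cubes X ∧ IsRConnected G.Adj A ∧
      (A.card : ℝ) ≤ c₀ * (1 + S.dRel X)

/-- A chosen animal for each domain under the leaf (the cubes of X if `S(X) = ∅`). [folklore] -/
noncomputable def animal {c₀ : ℝ} (hL : G.RelAnimalLeaf c₀) (X : S.Dom) : Finset G.Cube :=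
  if h : (G.small X).Nonempty then Classical.choose (hL X h) else G.cubes X

/-- The chosen animal has the leaf's properties. [folklore] -/
theorem animal_spec {c₀ : ℝ} (hL : G.RelAnimalLeaf c₀) {X : S.Dom} (h : (G.small X).Nonempty) :
    G.small X ⊆ G.animal hL X ∧ G.animal hL X ⊆ G.cubes X ∧ IsRConnected G.Adj (G.animal hL X) ∧
      ((G.animal hL X).card : ℝ) ≤ c₀ * (1 + S.dRel X) := by
  unfold animal
  rw [dif_pos h]
  exact Classical.choose_spec (hL X h)

/-! ## 4. The count: an admissible domain is determined by its small part and the components of `Z_j` it contains -/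

/-- The `Adj`-components of `Z_j` contained in `X` (for admissible X: those it meets, p. 262). [cite: Balaban1988Convergent, p.262 ll.6-15] -/
noncomputable def comps (X : S.Dom) : Finset (Finset G.Cube) :=
  (rcomponents G.Adj G.Z).filter (· ⊆ G.cubes X)

/-- The components of `Z_j` through the neighbours of a family `A` (a superset of the components adjacent to `A`;
Dimock L6941 *"the number of non-empty X ∩ Ω^c_α is at most 2^d|Y|_M"*, here `≤ Δ·#A`). [cite: Dimock2013BalabanII, App. E Lemma E.3 proof (arXiv:1212.5562v2 TeX L6936-6944)] -/
noncomputable def adjComps (A : Finset G.Cube) : Finset (Finset G.Cube) :=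
  (A.biUnion G.nbr).image (rcomponent G.Adj G.Z)

/-- `#adjComps A ≤ Δ·#A` under the degree bound. [cite: Dimock2013BalabanII, App. E Lemma E.3 proof (arXiv:1212.5562v2 TeX L6936-6944)] -/
theorem card_adjComps_le {Δ : ℕ} (hΔ : G.DegreeLE Δ) (A : Finset G.Cube) :
    (G.adjComps A).card ≤ Δ * A.card := by
  unfold adjComps
  refine Finset.card_image_le.trans (Finset.card_biUnion_le.trans ?_)
  calc ∑ a ∈ A, (G.nbr a).card ≤ ∑ a ∈ A, Δ := Finset.sum_le_sum fun a _ => hΔ a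
    _ = Δ * A.card := by rw [Finset.sum_const, smul_eq_mul, mul_comm]

/-- The component of `Z_j` through a `Z_j`-cube of an admissible X is one of `comps X`. [folklore] -/
theorem rcomponent_mem_comps {X : S.Dom} (hX : X ∈ G.adm) {a : G.Cube} (ha : a ∈ G.cubes X) (haZ : a ∈ G.Z) :
    rcomponent G.Adj G.Z a ∈ G.comps X := by
  unfold comps
  rw [Finset.mem_filter]
  exact ⟨mem_rcomponents_iff.2 ⟨a, haZ, rfl⟩, G.rcomponent_subset_cubes hX ha⟩

/-- Every component of `Z_j` inside an admissible X with `S(X) ⊆ A`, `S(X) ≠ ∅`, passes through a neighbour of `A`: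
walk inside the connected X from the component to a small cube; the first exit from the component is a step from a
cube of the component to a cube of X outside `Z_j`, i.e. of `S(X) ⊆ A` (Dimock L6940 *"Since X is connected each
non-empty X ∩ Ω^c_α must have a block sharing a face with a block in Y"*). [cite: Dimock2013BalabanII, App. E Lemma E.3 proof (arXiv:1212.5562v2 TeX L6936-6944)] -/
theorem comps_subset_adjComps {X : S.Dom} {A : Finset G.Cube} (hA : G.small X ⊆ A)
    (hne : (G.small X).Nonempty) : G.comps X ⊆ G.adjComps A := by
  intro C hC
  rw [comps, Finset.mem_filter] at hC
  obtain ⟨hCmem, hCX⟩ := hC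
  obtain ⟨p, hpZ, rfl⟩ := mem_rcomponents_iff.1 hCmem
  obtain ⟨s, hs⟩ := hne
  have hsX : s ∈ G.cubes X := (G.mem_small.1 hs).1
  have hsZ : s ∉ G.Z := (G.mem_small.1 hs).2
  have hpX : p ∈ G.cubes X := hCX (mem_rcomponent_self hpZ)
  have hchain := (G.connected X).2 p hpX s hsX
  obtain ⟨x, y, hxy, hxC, hyC⟩ := exists_exit (fun v => v ∈ rcomponent G.Adj G.Z p) hchain
    (mem_rcomponent_self hpZ) (fun h => hsZ (rcomponent_subset _ _ h))
  have hyZ : y ∉ G.Z := by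
    intro hyZ
    apply hyC
    obtain ⟨hxZ', hpx⟩ := mem_rcomponent.1 hxC
    exact mem_rcomponent.2 ⟨hyZ, hpx.tail ⟨hxy.1, hxZ', hyZ⟩⟩
  have hyA : y ∈ A := hA (G.mem_small.2 ⟨hxy.2.2, hyZ⟩)
  have hxnbr : x ∈ G.nbr y := G.mem_nbr y x (G.adj_symm x y hxy.1)
  rw [adjComps, Finset.mem_image]
  exact ⟨x, Finset.mem_biUnion.2 ⟨y, hyA, hxnbr⟩, rcomponent_eq_of_mem G.adj_symm hxC⟩

/-- Two admissible domains with the same small part and the same contained components have the same cubes (every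
cube of X is small or lies in its `Z_j`-component, which is contained in X by p. 262). [cite: Balaban1988Convergent, p.262 ll.6-15] -/
theorem cubes_subset_of_code_eq {X X' : S.Dom} (hX : X ∈ G.adm)
    (hs : G.small X = G.small X') (hc : G.comps X = G.comps X') : G.cubes X ⊆ G.cubes X' := by
  intro a ha
  by_cases haZ : a ∈ G.Z
  · have hmem : rcomponent G.Adj G.Z a ∈ G.comps X' := hc ▸ G.rcomponent_mem_comps hX ha haZ
    rw [comps, Finset.mem_filter] at hmem
    exact hmem.2 (mem_rcomponent_self haZ)
  · have hmem : a ∈ G.small X' := hs ▸ G.mem_small.2 ⟨ha, haZ⟩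
    exact (G.mem_small.1 hmem).1

/-- The code `X ↦ (S(X), comps X)` is injective on the admissible domains (a domain IS its family of cubes,
`cubes_injective`). [folklore] -/
theorem code_injOn : Set.InjOn (fun X => (G.small X, G.comps X)) ↑G.adm := by
  intro X hX X' hX' h
  obtain ⟨h1, h2⟩ := Prod.mk.inj h
  exact G.cubes_injective (Finset.Subset.antisymm (G.cubes_subset_of_code_eq hX h1 h2)
    (G.cubes_subset_of_code_eq hX' h1.symm h2.symm))

/-- The code of an admissible X with `∅ ≠ S(X) ⊆ A` lies in `𝒫(A) × 𝒫(adjComps A)`. [folklore] -/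
theorem code_mem {X : S.Dom} {A : Finset G.Cube} (hA : G.small X ⊆ A)
    (hne : (G.small X).Nonempty) :
    (G.small X, G.comps X) ∈ A.powerset ×ˢ (G.adjComps A).powerset := by
  rw [Finset.mem_product, Finset.mem_powerset, Finset.mem_powerset]
  exact ⟨hA, G.comps_subset_adjComps hA hne⟩

/-- THE FIBRE COUNT (Dimock L6942–6944 *"Counting the number of X's generating a particular Y means choosing a subset
of this set. Thus there are less than 2^{2^d|Y|_M} such X"*, with the animal `A ⊇ S(X)` in place of `Y = X∩Ω` and the
extra choice of `S(X) ⊆ A`): at most `2^{#A}·2^{Δ·#A}` admissible domains have nonempty small part inside `A`. [cite: Dimock2013BalabanII, App. E Lemma E.3 proof (arXiv:1212.5562v2 TeX L6936-6944)] -/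
theorem card_fibre_le {Δ : ℕ} (hΔ : G.DegreeLE Δ) (T : Finset S.Dom) (hT : T ⊆ G.adm) (A : Finset G.Cube)
    (hTA : ∀ X ∈ T, G.small X ⊆ A ∧ (G.small X).Nonempty) :
    T.card ≤ 2 ^ A.card * 2 ^ (Δ * A.card) := by
  calc T.card ≤ (A.powerset ×ˢ (G.adjComps A).powerset).card :=
        Finset.card_le_card_of_injOn (fun X => (G.small X, G.comps X))
          (fun X hX => G.code_mem (hTA X hX).1 (hTA X hX).2)
          (G.code_injOn.mono (Finset.coe_subset.2 hT))
    _ = 2 ^ A.card * 2 ^ (G.adjComps A).card := by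
        rw [Finset.card_product, Finset.card_powerset, Finset.card_powerset]
    _ ≤ 2 ^ A.card * 2 ^ (Δ * A.card) :=
        Nat.mul_le_mul_left _ (Nat.pow_le_pow_right (by norm_num) (G.card_adjComps_le hΔ A))

end RelCubeSystem

/-! ## 5. The constants and the relative tree-graph bound (Lemma E.3 / (snow) / H4) -/

/-- `arel(Δ) = a₀(Δ) + (Δ+1)·log 2`: the per-cube decay rate at which the animal sum weighted by the fibre count
`(2^{Δ+1})^{#A}` converges (`2^{Δ+1}e^{−arel} = e^{−a₀}`, `(Δ+1)²e^{−a₀} = ½`; pv03's `a₀(Δ) = log(2(Δ+1)²)`).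
[cite: Dimock2013BalabanII, App. E Lemma E.3 proof (arXiv:1212.5562v2 TeX L6945-6966)] -/
noncomputable def arel (Δ : ℕ) : ℝ := a₀ Δ + ((Δ : ℝ) + 1) * Real.log 2

/-- `kapparel(c₀, Δ) = c₀·arel(Δ)`: the threshold "κ₀ large enough" of Lemma E.3 on this route (Dimock L6950 *"if κ₀ is
large enough"*, L6966 *"provided κ₀ > 4a"*). [cite: Dimock2013BalabanII, App. E Lemma E.3 (arXiv:1212.5562v2 TeX L6914-6966)] -/
noncomputable def kapparel (c₀ : ℝ) (Δ : ℕ) : ℝ := c₀ * arel Δ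

/-- `Krel(c₀, Δ) = e^{kapparel}(Δ+1)^{−2}`: the constant `K₀ = 𝒪(1)` of Lemma E.3 on this route (depends on the
dimension through (c₀, Δ) only). [cite: Dimock2013BalabanII, App. E Lemma E.3 (arXiv:1212.5562v2 TeX L6914-6920)] -/
noncomputable def Krel (c₀ : ℝ) (Δ : ℕ) : ℝ := Real.exp (kapparel c₀ Δ) / ((Δ : ℝ) + 1) ^ 2

/-- `arel ≥ 0`. [folklore] -/
theorem arel_nonneg (Δ : ℕ) : 0 ≤ arel Δ := by
  unfold arel
  have h1 : 0 ≤ a₀ Δ := a₀_nonneg Δ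
  have h2 : 0 ≤ ((Δ : ℝ) + 1) * Real.log 2 := by positivity
  linarith

/-- `kapparel ≥ 0` for `c₀ ≥ 0`. [folklore] -/
theorem kapparel_nonneg {c₀ : ℝ} (hc₀ : 0 ≤ c₀) (Δ : ℕ) : 0 ≤ kapparel c₀ Δ :=
  mul_nonneg hc₀ (arel_nonneg Δ)

/-- `Krel > 0`. [folklore] -/
theorem Krel_pos (c₀ : ℝ) (Δ : ℕ) : 0 < Krel c₀ Δ := by
  unfold Krel
  positivity

/-- `2^{Δ+1}·e^{−arel(Δ)} = e^{−a₀(Δ)}`: the fibre count is absorbed into pv03's animal activity. [folklore] -/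
theorem two_pow_mul_exp_neg_arel (Δ : ℕ) : (2 : ℝ) ^ (Δ + 1) * Real.exp (-arel Δ) = Real.exp (-a₀ Δ) := by
  have h2 : Real.exp (((Δ : ℝ) + 1) * Real.log 2) = (2 : ℝ) ^ (Δ + 1) := by
    have hcast : ((Δ : ℝ) + 1) = ((Δ + 1 : ℕ) : ℝ) := by push_cast; ring
    rw [hcast, Real.exp_nat_mul, Real.exp_log (by norm_num : (0 : ℝ) < 2)]
  have hpos : (0 : ℝ) < (2 : ℝ) ^ (Δ + 1) := by positivity
  unfold arel
  rw [neg_add, Real.exp_add, Real.exp_neg (((Δ : ℝ) + 1) * Real.log 2), h2]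
  field_simp

namespace RelCubeSystem

variable {S : B16.RelDomainSys} (G : RelCubeSystem S)

/-- TERMWISE (Dimock L6945–6950 *"But |Y|_M ≤ 𝒪(1)ℓ_M(Y) + 𝒪(1) by lemma E.1 and so if κ₀ is large enough …"*, on the
animal route): under the leaf and `κ ≥ kapparel c₀ Δ`, for a domain with `S(X) ≠ ∅`,
`exp(−κ·d_{j,Z_j}(X)) ≤ e^{kapparel}·(e^{−arel})^{#animal X}` (uses `dRel ≥ 0`, b02's `dRel_nonneg`). [cite: Dimock2013BalabanII, App. E Lemma E.3 proof (arXiv:1212.5562v2 TeX L6945-6966)] -/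
theorem exp_rel_le {c₀ : ℝ} (hL : G.RelAnimalLeaf c₀) {Δ : ℕ} {κ : ℝ} (hκ : kapparel c₀ Δ ≤ κ)
    {X : S.Dom} (h : (G.small X).Nonempty) :
    Real.exp (-κ * S.dRel X) ≤ Real.exp (kapparel c₀ Δ) * Real.exp (-arel Δ) ^ (G.animal hL X).card := by
  rw [← Real.exp_nat_mul, ← Real.exp_add]
  apply Real.exp_le_exp.2
  have hd : 0 ≤ S.dRel X := S.dRel_nonneg X
  have hA : ((G.animal hL X).card : ℝ) ≤ c₀ * (1 + S.dRel X) := (G.animal_spec hL h).2.2.2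
  have ha : 0 ≤ arel Δ := arel_nonneg Δ
  have h1 : arel Δ * ((G.animal hL X).card : ℝ) ≤ arel Δ * (c₀ * (1 + S.dRel X)) :=
    mul_le_mul_of_nonneg_left hA ha
  have h2 : kapparel c₀ Δ * S.dRel X ≤ κ * S.dRel X := mul_le_mul_of_nonneg_right hκ hd
  unfold kapparel at h2 ⊢
  nlinarith

/-- **THE RELATIVE ANCHORED TREE-GRAPH BOUND = [Dimock2013BalabanII] Lemma E.3 (sumsum) / §3.1.2 (snow) / hypothesis H4 of
cell GAPS C-b01-J1, KERNEL-CHECKED modulo the leaf, with explicit constants**: if every cube has at most `Δ`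
neighbours and `RelAnimalLeaf c₀` holds, then for every `κ ≥ kapparel c₀ Δ` and every cube □,
`Σ_{X ∈ adm, □ ∈ S(X)} exp(−κ·d_{j,Z_j}(X)) ≤ Krel c₀ Δ`.  Route (module docstring §5): termwise `exp_rel_le`, regroup
over the chosen animals (`card_fibre_le`), then the tree's connected-animal count `sum_pow_card_le_of_connected` at
activity `2^{Δ+1}e^{−arel} = e^{−a₀}` (`smallness_a₀`).  Printed statement verbatim (L6914–6920): *"Let Ω be a union
of M-cubes. For □ ⊂ Ω and constants κ₀, K₀ = 𝒪(1):  Σ_{X ∈ 𝒟_k(mod Ω^c), X ⊃ □} exp(−κ₀ d_M(X, mod Ω^c)) ≤ K₀"*.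
[cite: Dimock2013BalabanII, App. E Lemma E.3 (arXiv:1212.5562v2 TeX L6914-6966)] -/
theorem relTreeBound {Δ : ℕ} (hΔ : G.DegreeLE Δ) {c₀ : ℝ} (hL : G.RelAnimalLeaf c₀) {κ : ℝ}
    (hκ : kapparel c₀ Δ ≤ κ) (c : G.Cube) :
    ∑ X ∈ G.adm.filter (fun X => c ∈ G.small X), Real.exp (-κ * S.dRel X) ≤ Krel c₀ Δ := by
  classical
  set T := G.adm.filter (fun X => c ∈ G.small X) with hT
  have hTadm : T ⊆ G.adm := Finset.filter_subset _ _
  have hTc : ∀ X ∈ T, c ∈ G.small X := fun X hX => (Finset.mem_filter.1 hX).2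
  have hTne : ∀ X ∈ T, (G.small X).Nonempty := fun X hX => ⟨c, hTc X hX⟩
  set μ : ℝ := Real.exp (-arel Δ) with hμ
  have hμ0 : 0 ≤ μ := Real.exp_nonneg _
  -- Step 1: termwise
  have step1 : ∑ X ∈ T, Real.exp (-κ * S.dRel X)
      ≤ ∑ X ∈ T, Real.exp (kapparel c₀ Δ) * μ ^ (G.animal hL X).card :=
    Finset.sum_le_sum fun X hX => G.exp_rel_le hL hκ (hTne X hX)
  refine step1.trans ?_
  rw [← Finset.mul_sum]
  -- Step 2: regroup over the animals
  set 𝒴 := T.image (G.animal hL) with h𝒴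
  have hfib : ∑ X ∈ T, μ ^ (G.animal hL X).card
      = ∑ A ∈ 𝒴, ((T.filter (fun X => G.animal hL X = A)).card : ℝ) * μ ^ A.card := by
    rw [← Finset.sum_fiberwise_of_maps_to (s := T) (t := 𝒴) (g := G.animal hL)
      (fun X hX => Finset.mem_image_of_mem _ hX)]
    refine Finset.sum_congr rfl fun A _ => ?_
    rw [Finset.sum_congr rfl (fun X hX => by rw [(Finset.mem_filter.1 hX).2]), Finset.sum_const, nsmul_eq_mul]
  -- Step 3: the fibre count, absorbed into the activity
  have hlam : (2 : ℝ) ^ (Δ + 1) * μ = Real.exp (-a₀ Δ) := two_pow_mul_exp_neg_arel Δ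
  have hcount : ∀ A ∈ 𝒴, ((T.filter (fun X => G.animal hL X = A)).card : ℝ) * μ ^ A.card
      ≤ Real.exp (-a₀ Δ) ^ A.card := by
    intro A _
    have hTA : ∀ X ∈ T.filter (fun X => G.animal hL X = A), G.small X ⊆ A ∧ (G.small X).Nonempty := by
      intro X hX
      obtain ⟨hXT, hXA⟩ := Finset.mem_filter.1 hX
      exact ⟨hXA ▸ (G.animal_spec hL (hTne X hXT)).1, hTne X hXT⟩
    have hnat := G.card_fibre_le hΔ (T.filter (fun X => G.animal hL X = A))
      ((Finset.filter_subset _ _).trans hTadm) A hTA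
    have hreal : ((T.filter (fun X => G.animal hL X = A)).card : ℝ) ≤ (2 : ℝ) ^ A.card * 2 ^ (Δ * A.card) := by
      exact_mod_cast hnat
    have hexp : A.card + Δ * A.card = (Δ + 1) * A.card := by ring
    calc ((T.filter (fun X => G.animal hL X = A)).card : ℝ) * μ ^ A.card
        ≤ ((2 : ℝ) ^ A.card * 2 ^ (Δ * A.card)) * μ ^ A.card :=
          mul_le_mul_of_nonneg_right hreal (pow_nonneg hμ0 _)
      _ = ((2 : ℝ) ^ (Δ + 1) * μ) ^ A.card := by
          rw [mul_pow, ← pow_mul, ← pow_add, hexp]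
      _ = Real.exp (-a₀ Δ) ^ A.card := by rw [hlam]
  -- Step 4: the connected-animal count of the tree
  have h𝒴conn : ∀ Y ∈ 𝒴, c ∈ Y ∧ IsRConnected G.Adj Y := by
    intro Y hY
    obtain ⟨X, hX, rfl⟩ := Finset.mem_image.1 hY
    exact ⟨(G.animal_spec hL (hTne X hX)).1 (hTc X hX), (G.animal_spec hL (hTne X hX)).2.2.1⟩
  have hanimal : ∑ A ∈ 𝒴, Real.exp (-a₀ Δ) ^ A.card ≤ 2 * Real.exp (-a₀ Δ) :=
    sum_pow_card_le_of_connected (R := G.Adj) (nbr := G.nbr) (Δ := Δ) G.adj_symm hΔ G.mem_nbr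
      (Real.exp_nonneg _) (smallness_a₀ Δ) c 𝒴 h𝒴conn
  have hK : Real.exp (kapparel c₀ Δ) * (2 * Real.exp (-a₀ Δ)) = Krel c₀ Δ := by
    have hpos : (0 : ℝ) < ((Δ : ℝ) + 1) ^ 2 := by positivity
    rw [exp_neg_a₀, Krel]
    field_simp
  rw [hfib, ← hK]
  exact mul_le_mul_of_nonneg_left ((Finset.sum_le_sum hcount).trans hanimal) (Real.exp_nonneg _)

/-- Lemma E.3 in its printed shape `X ⊃ □`, `□ ⊂ Ω` (□ a small-field cube: `□ ∉ Z_j`, so `□ ∈ X ⇔ □ ∈ S(X)`).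
[cite: Dimock2013BalabanII, App. E Lemma E.3 (arXiv:1212.5562v2 TeX L6914-6920)] -/
theorem sumsum {Δ : ℕ} (hΔ : G.DegreeLE Δ) {c₀ : ℝ} (hL : G.RelAnimalLeaf c₀) {κ : ℝ}
    (hκ : kapparel c₀ Δ ≤ κ) (c : G.Cube) (hc : c ∉ G.Z) :
    ∑ X ∈ G.adm.filter (fun X => c ∈ G.cubes X), Real.exp (-κ * S.dRel X) ≤ Krel c₀ Δ := by
  classical
  have hset : G.adm.filter (fun X => c ∈ G.cubes X) = G.adm.filter (fun X => c ∈ G.small X) :=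
    Finset.filter_congr fun X _ => by
      rw [G.mem_small]
      exact ⟨fun h => ⟨h, hc⟩, fun h => h.1⟩
  rw [hset]
  exact G.relTreeBound hΔ hL hκ c

/-! ## 6. The anchors of `B14.RelBoundary` as theorems (H2), and H1 -/

/-- A PURE admissible domain (`S(X) = ∅`) is the `Adj`-component of `Z_j` through any of its cubes (connected inside
`Z_j`, and containing the component by p. 262). [cite: Balaban1988Convergent, p.262 ll.6-15] -/
theorem cubes_eq_rcomponent_of_pure {X : S.Dom} (hX : X ∈ G.adm) (h : G.small X = ∅) {c : G.Cube}
    (hc : c ∈ G.cubes X) : G.cubes X = rcomponent G.Adj G.Z c := by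
  have hXZ := G.cubes_subset_Z_of_small_eq_empty h
  apply Finset.Subset.antisymm
  · intro v hv
    have hchain := (G.connected X).2 c hc v hv
    refine mem_rcomponent.2 ⟨hXZ hv, ?_⟩
    clear hv
    induction hchain with
    | refl => exact Relation.ReflTransGen.refl
    | @tail b c' _ hbc ih => exact ih.tail ⟨hbc.1, hXZ hbc.2.1, hXZ hbc.2.2⟩
  · exact G.rcomponent_subset_cubes hX hc

/-- Two pure admissible domains sharing a cube coincide ("distinct components ⇒ distinct anchors", GAPS C-b01-J1
derivation). [cite: Balaban1988Convergent, p.262 ll.6-15] -/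
theorem eq_of_pure_of_mem {X X' : S.Dom} (hX : X ∈ G.adm) (hX' : X' ∈ G.adm) (h : G.small X = ∅)
    (h' : G.small X' = ∅) {c : G.Cube} (hc : c ∈ G.cubes X) (hc' : c ∈ G.cubes X') : X = X' :=
  G.cubes_injective ((G.cubes_eq_rcomponent_of_pure hX h hc).trans (G.cubes_eq_rcomponent_of_pure hX' h' hc').symm)

/-- H2, non-pure case: an admissible domain with `S(X) ≠ ∅` contains a small cube ADJACENT TO `Z_j` (a cube of the
first M-layer of Λ_j): by (2.41) X has a cube in `Z_j^~`; if that cube is in `Z_j`, walk inside the connected X to a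
small cube and take the first exit from `Z_j`. [cite: Balaban1988Convergent, (2.41) p.261] -/
theorem exists_small_firstLayer {X : S.Dom} (hX : X ∈ G.adm) (hne : (G.small X).Nonempty) :
    ∃ s ∈ G.small X, ∃ b ∈ G.Z, G.Adj s b := by
  obtain ⟨a, haX, ha⟩ := G.meets_Ztilde X hX
  obtain ⟨s₀, hs₀⟩ := hne
  by_cases haZ : a ∈ G.Z
  · have hchain := (G.connected X).2 a haX s₀ (G.mem_small.1 hs₀).1
    obtain ⟨x, y, hxy, hxZ, hyZ⟩ := exists_exit (fun v => v ∈ G.Z) hchain haZ (G.mem_small.1 hs₀).2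
    exact ⟨y, G.mem_small.2 ⟨hxy.2.2, hyZ⟩, x, hxZ, G.adj_symm x y hxy.1⟩
  · rcases ha with haZ' | ⟨b, hbZ, hab⟩
    · exact absurd haZ' haZ
    · exact ⟨a, G.mem_small.2 ⟨haX, haZ⟩, b, hbZ, hab⟩

/-- A small-field cube adjacent to `Z_j` lies in `Λ_j∖Λ_j^0 ⊆ ring` (it is in Λ_j by (2.3), and not in Λ_j^0, whose
cubes have all their neighbours in Λ_j, p. 259). [cite: Balaban1988Convergent, p.259] -/
theorem mem_ring_of_firstLayer {s b : G.Cube} (hs : s ∉ G.Z) (hb : b ∈ G.Z) (hsb : G.Adj s b) :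
    s ∈ G.ring := by
  rw [ring, Finset.mem_sdiff]
  have hsLam : s ∈ G.Lam := by
    by_contra h
    exact hs ((G.mem_Z_iff s).2 h)
  refine ⟨G.lam_subset_omega hsLam, fun hs0 => ?_⟩
  exact ((G.mem_Z_iff b).1 hb) (G.layer s hs0 b hsb)

/-- THE ANCHOR EXISTS (H2 of GAPS C-b01-J1): every domain has a cube which, if the domain is admissible, lies in the
ring `Ω_j∖Λ_j^0` and is either a cube of a PURE domain (then in `X∩Ω_j ⊆ Ω_j∖Λ_j` by (2.41) and (2.3)) or a cube of
`S(X)`. [cite: Balaban1988Convergent, (2.41) p.261, p.262 ll.6-15] -/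
theorem exists_anchor (X : S.Dom) : ∃ c : G.Cube, c ∈ G.cubes X ∧
    (X ∈ G.adm → c ∈ G.ring ∧ (G.small X = ∅ ∨ c ∈ G.small X)) := by
  by_cases hX : X ∈ G.adm
  · by_cases h : G.small X = ∅
    · obtain ⟨a, haX, haO⟩ := G.meets_omega X hX
      have haZ : a ∈ G.Z := G.cubes_subset_Z_of_small_eq_empty h haX
      refine ⟨a, haX, fun _ => ⟨?_, Or.inl h⟩⟩
      rw [ring, Finset.mem_sdiff]
      exact ⟨haO, fun ha0 => ((G.mem_Z_iff a).1 haZ) (G.lam0_subset_lam ha0)⟩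
    · obtain ⟨s, hs, b, hb, hsb⟩ := G.exists_small_firstLayer hX (Finset.nonempty_iff_ne_empty.2 h)
      exact ⟨s, (G.mem_small.1 hs).1, fun _ =>
        ⟨G.mem_ring_of_firstLayer (G.mem_small.1 hs).2 hb hsb, Or.inr hs⟩⟩
  · obtain ⟨c, hc⟩ := (G.connected X).1
    exact ⟨c, hc, fun h => absurd h hX⟩

/-- The anchor map (a choice). [cite: Balaban1988Convergent, (2.48) p.264] -/
noncomputable def anchor (X : S.Dom) : G.Cube := Classical.choose (G.exists_anchor X)

/-- The anchor's properties. [folklore] -/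
theorem anchor_spec (X : S.Dom) : G.anchor X ∈ G.cubes X ∧
    (X ∈ G.adm → G.anchor X ∈ G.ring ∧ (G.small X = ∅ ∨ G.anchor X ∈ G.small X)) :=
  Classical.choose_spec (G.exists_anchor X)

/-- **The anchoring data of `B14.RelBoundary` CONSTRUCTED** (gen 2 carried `anchor_mem`/`mem_above` as located
hypotheses H1–H2): ring = `Ω_j∖Λ_j^0`, anchor = `anchor`, fibres = the level sets of the anchor map on `adm`.
[cite: Balaban1988Convergent, (2.48) p.264] -/
noncomputable def ringAnchor : B14.RelBoundary.RingAnchor S where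
  Cube := G.Cube
  adm := G.adm
  ring := G.ring
  above := fun c => G.adm.filter (fun X => G.anchor X = c)
  anchor := G.anchor
  anchor_mem := fun X hX => ((G.anchor_spec X).2 hX).1
  mem_above := fun _ hX => Finset.mem_filter.2 ⟨hX, rfl⟩

/-- **H4 DISCHARGED for the constructed anchoring**: under the degree bound, the leaf, `c₀ ≥ 0` and `κ ≥ kapparel c₀ Δ`,
`RelAnchoredBound S ringAnchor κ (Krel c₀ Δ + 1)` — the fibre of a ring cube splits into the pure domains anchored
there (at most ONE, `eq_of_pure_of_mem`, each term ≤ 1) and the non-pure ones (anchored at a cube of their small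
part: `≤ relTreeBound`). [cite: Dimock2013BalabanII, App. E Lemma E.3 (arXiv:1212.5562v2 TeX L6914-6966)] -/
theorem relAnchoredBound {Δ : ℕ} (hΔ : G.DegreeLE Δ) {c₀ : ℝ} (hc₀ : 0 ≤ c₀) (hL : G.RelAnimalLeaf c₀)
    {κ : ℝ} (hκ : kapparel c₀ Δ ≤ κ) :
    B14.RelBoundary.RelAnchoredBound S G.ringAnchor κ (Krel c₀ Δ + 1) := by
  classical
  intro c _
  change ∑ X ∈ G.adm.filter (fun X => G.anchor X = c), Real.exp (-κ * S.dRel X) ≤ Krel c₀ Δ + 1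
  have hκ0 : 0 ≤ κ := (kapparel_nonneg hc₀ Δ).trans hκ
  set F := G.adm.filter (fun X => G.anchor X = c) with hF
  rw [← Finset.sum_filter_add_sum_filter_not F (fun X => G.small X = ∅)]
  -- the pure part: at most one term, each ≤ 1
  have hPcard : (F.filter (fun X => G.small X = ∅)).card ≤ 1 := by
    refine Finset.card_le_one.2 fun X hX X' hX' => ?_
    obtain ⟨hXF, hXp⟩ := Finset.mem_filter.1 hX
    obtain ⟨hX'F, hX'p⟩ := Finset.mem_filter.1 hX'
    obtain ⟨hXadm, hXc⟩ := Finset.mem_filter.1 hXF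
    obtain ⟨hX'adm, hX'c⟩ := Finset.mem_filter.1 hX'F
    have hcX : c ∈ G.cubes X := hXc ▸ (G.anchor_spec X).1
    have hcX' : c ∈ G.cubes X' := hX'c ▸ (G.anchor_spec X').1
    exact G.eq_of_pure_of_mem hXadm hX'adm hXp hX'p hcX hcX'
  have hP : ∑ X ∈ F.filter (fun X => G.small X = ∅), Real.exp (-κ * S.dRel X) ≤ 1 := by
    have hterm : ∀ X ∈ F.filter (fun X => G.small X = ∅), Real.exp (-κ * S.dRel X) ≤ 1 := by
      intro X _
      apply Real.exp_le_one_iff.2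
      have hd : 0 ≤ S.dRel X := S.dRel_nonneg X
      nlinarith
    refine (Finset.sum_le_sum hterm).trans ?_
    rw [Finset.sum_const, nsmul_eq_mul, mul_one]
    exact_mod_cast hPcard
  -- the non-pure part: anchored inside the small part
  have hNsub : F.filter (fun X => ¬ G.small X = ∅) ⊆ G.adm.filter (fun X => c ∈ G.small X) := by
    intro X hX
    obtain ⟨hXF, hXn⟩ := Finset.mem_filter.1 hX
    obtain ⟨hXadm, hXc⟩ := Finset.mem_filter.1 hXF
    refine Finset.mem_filter.2 ⟨hXadm, ?_⟩
    rcases ((G.anchor_spec X).2 hXadm).2 with hp | hs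
    · exact absurd hp hXn
    · exact hXc ▸ hs
  have hN : ∑ X ∈ F.filter (fun X => ¬ G.small X = ∅), Real.exp (-κ * S.dRel X) ≤ Krel c₀ Δ :=
    (Finset.sum_le_sum_of_subset_of_nonneg hNsub (fun X _ _ => Real.exp_nonneg _)).trans
      (G.relTreeBound hΔ hL hκ c)
  linarith

/-- H1 of GAPS C-b01-J1: given `Ω_{j+1} ⊂ Λ_j^0` (forced by the construction (3.5) p. 265 with (2.9), kernel-located in
unit pv02's `B14DomainGeom.omega35_subset_lambda0`, cell GAPS C-B14s-05), the ring `Ω_j∖Λ_j^0` lies in `Γ_j =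
Ω_j∖Ω_{j+1}` ((2.2) p. 255). [cite: Balaban1988Convergent, (2.2) p.255, (3.5) p.265] -/
theorem ring_subset_Gamma (OmegaNext : Finset G.Cube) (h35 : OmegaNext ⊆ G.Lam0) :
    G.ring ⊆ G.Omega \ OmegaNext := by
  intro c hc
  rw [ring, Finset.mem_sdiff] at hc
  exact Finset.mem_sdiff.2 ⟨hc.1, fun h => hc.2 (h35 h)⟩

/-- Hence `#ring ≤ #(cubes of Γ_j)`. [cite: Balaban1988Convergent, (2.48) p.264] -/
theorem card_ring_le (OmegaNext : Finset G.Cube) (h35 : OmegaNext ⊆ G.Lam0) :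
    G.ring.card ≤ (G.Omega \ OmegaNext).card :=
  Finset.card_le_card (G.ring_subset_Gamma OmegaNext h35)

/-! ## 7. The per-scale bound with H2/H4 discharged -/

/-- **THE PER-SCALE BOUND OF GAPS C-b01-J1 WITH ITS ANCHORING HYPOTHESES DISCHARGED** (gen 2's
`B14.RelBoundary.scaleBound_of_relDecay` fed with `ringAnchor` and `relAnchoredBound`): if the resummed boundary terms
of scale j satisfy, at one configuration, *"(2.42) with d_j(X) replaced by d_j(X∖Z_j)"* — `‖B X‖ ≤ B₀exp(−κ·d_{j,Z_j}(X))`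
on `adm` — with `κ ≥ kapparel c₀ Δ`, then `‖Σ_{X∈adm} B X‖ ≤ B₀·(Krel c₀ Δ + 1)·#(cubes of Ω_j∖Λ_j^0)`, modulo the
degree bound and the leaf. [cite: Balaban1988Convergent, (2.47)-(2.48) pp.263-264] -/
theorem scaleBound {Δ : ℕ} (hΔ : G.DegreeLE Δ) {c₀ : ℝ} (hc₀ : 0 ≤ c₀) (hL : G.RelAnimalLeaf c₀) {κ : ℝ}
    (hκ : kapparel c₀ Δ ≤ κ) {Φ : Type*} (B : S.Dom → Φ → ℂ) (φ : S.Dom → Φ) (B₀ : ℝ) (hB₀ : 0 ≤ B₀)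
    (hterm : ∀ X ∈ G.adm, ‖B X (φ X)‖ ≤ B₀ * Real.exp (-κ * S.dRel X)) :
    ‖∑ X ∈ G.adm, B X (φ X)‖ ≤ B₀ * (Krel c₀ Δ + 1) * G.ring.card :=
  B14.RelBoundary.scaleBound_of_relDecay S G.ringAnchor B φ B₀ κ (Krel c₀ Δ + 1) hB₀ hterm
    (G.relAnchoredBound hΔ hc₀ hL hκ)

/-- The same against the printed volume `|Γ_j|` of (2.48) (H1, `card_ring_le`): `‖Σ_{X∈adm} B X‖ ≤ B₀·(Krel c₀ Δ +
1)·#(cubes of Ω_j∖Ω_{j+1})`, i.e. the per-scale input of (2.48) with `B₁ = B₀(Krel + 1)M^{−d}` and no factor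
`2^{−(j−n)}`. [cite: Balaban1988Convergent, (2.48) p.264] -/
theorem scaleBound_Gamma {Δ : ℕ} (hΔ : G.DegreeLE Δ) {c₀ : ℝ} (hc₀ : 0 ≤ c₀) (hL : G.RelAnimalLeaf c₀) {κ : ℝ}
    (hκ : kapparel c₀ Δ ≤ κ) (OmegaNext : Finset G.Cube) (h35 : OmegaNext ⊆ G.Lam0) {Φ : Type*}
    (B : S.Dom → Φ → ℂ) (φ : S.Dom → Φ) (B₀ : ℝ) (hB₀ : 0 ≤ B₀)
    (hterm : ∀ X ∈ G.adm, ‖B X (φ X)‖ ≤ B₀ * Real.exp (-κ * S.dRel X)) :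
    ‖∑ X ∈ G.adm, B X (φ X)‖ ≤ B₀ * (Krel c₀ Δ + 1) * (G.Omega \ OmegaNext).card := by
  refine (G.scaleBound hΔ hc₀ hL hκ B φ B₀ hB₀ hterm).trans ?_
  have hK : 0 ≤ B₀ * (Krel c₀ Δ + 1) := mul_nonneg hB₀ (by have := Krel_pos c₀ Δ; linarith)
  exact mul_le_mul_of_nonneg_left (by exact_mod_cast G.card_ring_le OmegaNext h35) hK

end RelCubeSystem

end Literature.MathematicalPhysics.QuantumFieldTheory.Balaban1983to89.B14.RelAnimal
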